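import Summits.QuantumAdvantage.QuantumAdvantage.Theorems.LinnikCubicClassGroupsDegreeOnePrimesEscapeConjClassPNT
import Summits.QuantumAdvantage.QuantumAdvantage.Theorems.LinnikCubicClassGroupsDegreeOnePrimesEscapeDivisionPNTBounds
import HarnessLib

/-!
# Chebotarev bounds of the right order for CONJUGACY CLASSES in the Linnik range

Topic `Summits/QuantumAdvantage/QuantumAdvantage/Theorems`, cell B2b-1 (linnik-cubic), PART A (gen 13);
helper toward the crux `DegreeOnePrimesEscape` (stmt-QuantumAdvantage-11543) of route
`LinnikCubicClassGroups`.  HONEST FRAMING: the value of this file is a THEOREM (kernel-checked, GRH-free,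
Siegel-free, no hypothesis) — NOT summit progress.

Corollaries of the prime number theorem for conjugacy classes `frobeniusClass_PNT` (`…ConjClassPNT.lean`), the
class analogues of `…DivisionPNTBounds.lean`.  Notation: `N/ℚ` Galois of degree `n`, `G = Gal(N/ℚ)`, `σ ∈ G` NOT
generating `G`, `δ = |C(σ)|/|G|`, `d = |d_N|`, `S(x) = Σ_{p ≤ x, p ∤ d_N, Frob_p ∈ C(σ)} log p`; all bounds hold for
EVERY `x ≥ d^{L(n)}` (resp. `d^{L(n,ε)}`):

* `frobeniusClass_theta_le` — **Brun–Titchmarsh shape**: `S(x) ≤ 3 δ x`;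
* `frobeniusClass_theta_ge` — **a universal lower bound**: `S(x) ≥ C(n) δ x / d^{2(1+n²)}` (Stark's effective
  repulsion of the exceptional zero);
* `frobeniusClass_theta_ge_of_forall_index_two` — **the right order of magnitude whenever `σ` lies in no
  subgroup of index two**: `S(x) ≥ (1 − ε) δ x`; `frobeniusClass_theta_twoSided_of_forall_index_ne_two` — if `G`
  has NO subgroup of index two then `|S(x) − δ x| ≤ ε δ x` (no exceptional term at all);
* `frobeniusClass_card_ge_of_forall_index_two` — the prime COUNT `#{p ≤ x : p ∤ d_N, Frob_p ∈ C(σ)} ≥ (1 − ε) δ x / log x`.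

References: Lagarias–Montgomery–Odlyzko, Invent. Math. 54 (1979) [LagariasMontgomeryOdlyzko1979]; Thorner–Zaman,
Algebra Number Theory 13 (2019) [ThornerZaman2019]; H. M. Stark, Invent. Math. 23 (1974) [Stark1974].
-/

noncomputable section

open scoped NumberField nonZeroDivisors
open Finset Real Ideal NumberField
open Literature.NumberTheory.NumberFields Literature.NumberTheory.LFunctions
  Literature.NumberTheory.LFunctions.NumberField

namespace Summit.QuantumAdvantage.QuantumAdvantage.Theorems.DegreeOnePrimesEscape

variable {N : Type} [Field N] [NumberField N] [IsGalois ℚ N]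

omit [IsGalois ℚ N] in
/-- `1 ≤ |C(σ)|`. -/
theorem one_le_card_isConj (σ : N ≃ₐ[ℚ] N) : 1 ≤ Nat.card {τ : N ≃ₐ[ℚ] N // IsConj σ τ} := by
  haveI : Nonempty {τ : N ≃ₐ[ℚ] N // IsConj σ τ} := ⟨⟨σ, IsConj.refl σ⟩⟩
  exact Nat.one_le_iff_ne_zero.mpr Nat.card_pos.ne'

omit [IsGalois ℚ N] in
/-- `0 < δ ≤ 1` for the density `|C(σ)|/|G|` of a conjugacy class. -/
theorem classDensity_pos_le_one (σ : N ≃ₐ[ℚ] N) :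
    0 < (Nat.card {τ : N ≃ₐ[ℚ] N // IsConj σ τ} : ℝ) / Nat.card (N ≃ₐ[ℚ] N) ∧
      (Nat.card {τ : N ≃ₐ[ℚ] N // IsConj σ τ} : ℝ) / Nat.card (N ≃ₐ[ℚ] N) ≤ 1 := by
  classical
  have hG : (0 : ℝ) < Nat.card (N ≃ₐ[ℚ] N) := by exact_mod_cast Nat.card_pos
  have h1 : (1 : ℝ) ≤ Nat.card {τ : N ≃ₐ[ℚ] N // IsConj σ τ} := by exact_mod_cast one_le_card_isConj σ
  have h2 : (Nat.card {τ : N ≃ₐ[ℚ] N // IsConj σ τ} : ℝ) ≤ Nat.card (N ≃ₐ[ℚ] N) := by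
    exact_mod_cast Finite.card_subtype_le _
  exact ⟨div_pos (by linarith) hG, (div_le_one hG).mpr h2⟩

/-! ### The bounds -/

open scoped Classical in
/-- **Brun–Titchmarsh shape for a conjugacy class in the Linnik range**: for `n > 1` there is `L > 0` with
`S(x) ≤ 3 δ x` for every Galois `N` of degree `n`, every non-generating `σ`, every `x ≥ |d_N|^L`.  Unconditional.
[cite: LagariasMontgomeryOdlyzko1979, Theorem 1.1] -/
theorem frobeniusClass_theta_le (n : ℕ) (hn : 1 < n) :
    ∃ L : ℝ, 0 < L ∧ ∀ (N : Type) [Field N] [NumberField N] [IsGalois ℚ N],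
      Module.finrank ℚ N = n → ∀ σ : N ≃ₐ[ℚ] N, Subgroup.zpowers σ ≠ ⊤ → ∀ x : ℝ, ((NumberField.discr N).natAbs : ℝ) ^ L ≤ x →
        ∑ p ∈ (Nat.primesLE ⌊x⌋₊).filter
            (fun p : ℕ => ¬ ((p : ℤ) ∣ NumberField.discr N) ∧
              ∃ (Q : Ideal (𝓞 N)) (_ : Q.IsMaximal) (_ : Q.LiesOver (span {(p : ℤ)})) (φ g : N ≃ₐ[ℚ] N),
                IsArithFrobAt ℤ φ Q ∧ Q.inertia (N ≃ₐ[ℚ] N) = ⊥ ∧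
                  g * φ * g⁻¹ = σ), Real.log p ≤
          3 * ((Nat.card {τ : N ≃ₐ[ℚ] N // IsConj σ τ} : ℝ) / Nat.card (N ≃ₐ[ℚ] N)) * x := by
  obtain ⟨L, c, hL, hc, hc4, h⟩ := frobeniusClass_PNT n hn (ε := 1 / 7) (by norm_num) (by norm_num)
  refine ⟨L, hL, fun N _ _ _ hN σ hgen x hx => ?_⟩
  obtain ⟨hA, hB⟩ := h N hN σ hgen
  obtain ⟨hδ0, hδ1⟩ := classDensity_pos_le_one σ
  set δ : ℝ := (Nat.card {τ : N ≃ₐ[ℚ] N // IsConj σ τ} : ℝ) / Nat.card (N ≃ₐ[ℚ] N) with hδ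
  have hN1 : 1 < Module.finrank ℚ N := by rw [hN]; exact hn
  set d : ℝ := ((NumberField.discr N).natAbs : ℝ) with hd
  have hd3 : (3 : ℝ) ≤ d := three_le_natAbs_discr_real N hN1
  have hx1 : 1 ≤ x := le_trans (Real.one_le_rpow (by linarith) hL.le) hx
  have hx0 : 0 < x := by linarith
  have hδx : 0 ≤ δ * x := by positivity
  by_cases hexc : ∃ β₁ : ℝ, dedekindZeta₁ N β₁ = 0 ∧ 1 - c / (Real.log d + Real.log 4) < β₁ ∧ β₁ < 1
  · obtain ⟨β₁, hζ₁, hβ₁c, hβ₁1⟩ := hexc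
    have hβ34 : 3 / 4 ≤ β₁ := three_quarters_le_of_window hc hc4 hd3 hβ₁c
    have hβ0 : 0 < β₁ := by linarith
    have hy0 : 0 ≤ x ^ β₁ / β₁ := div_nonneg (Real.rpow_nonneg hx0.le _) hβ0.le
    have hyx : x ^ β₁ / β₁ ≤ 4 / 3 * x := by
      have h1 : x ^ β₁ ≤ x := by
        have := Real.rpow_le_rpow_of_exponent_le hx1 hβ₁1.le; rwa [Real.rpow_one] at this
      rw [div_le_iff₀ hβ0]; nlinarith
    obtain ⟨hB1, hB2⟩ := hB β₁ hζ₁ hβ₁c hβ₁1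
    by_cases hζσ : dedekindZeta₁ (IntermediateField.fixedField (Subgroup.zpowers σ)) β₁ = 0
    · obtain ⟨hxy, hb⟩ := hB1 hζσ x hx
      have := (abs_le.mp hb).2
      nlinarith
    · have hb := hB2 hζσ x hx
      have := (abs_le.mp hb).2
      nlinarith
  · have hb := hA hexc x hx
    have := (abs_le.mp hb).2
    nlinarith

open scoped Classical in
/-- **A universal lower bound for a conjugacy class in the Linnik range**: for `n > 1` there are `L, C > 0` with
`S(x) ≥ C δ x / |d_N|^{2(1+n²)}` for every Galois `N` of degree `n`, every non-generating `σ`, every `x ≥ |d_N|^L` (the loss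
`|d_N|^{−2(1+n²)}` only occurs when `σ` lies in the kernel of an exceptional quadratic character, by Stark's
effective bound for `1 − β₁`).  Unconditional. [cite: LagariasMontgomeryOdlyzko1979, Theorem 1.1]
[cite: Stark1974, Theorem 1'] -/
theorem frobeniusClass_theta_ge (n : ℕ) (hn : 1 < n) :
    ∃ L C : ℝ, 0 < L ∧ 0 < C ∧ ∀ (N : Type) [Field N] [NumberField N] [IsGalois ℚ N],
      Module.finrank ℚ N = n → ∀ σ : N ≃ₐ[ℚ] N, Subgroup.zpowers σ ≠ ⊤ → ∀ x : ℝ, ((NumberField.discr N).natAbs : ℝ) ^ L ≤ x →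
        C * (((Nat.card {τ : N ≃ₐ[ℚ] N // IsConj σ τ} : ℝ) / Nat.card (N ≃ₐ[ℚ] N)) * x) /
            ((NumberField.discr N).natAbs : ℝ) ^ (2 * ((1 : ℝ) + n * n)) ≤
          ∑ p ∈ (Nat.primesLE ⌊x⌋₊).filter
            (fun p : ℕ => ¬ ((p : ℤ) ∣ NumberField.discr N) ∧
              ∃ (Q : Ideal (𝓞 N)) (_ : Q.IsMaximal) (_ : Q.LiesOver (span {(p : ℤ)})) (φ g : N ≃ₐ[ℚ] N),
                IsArithFrobAt ℤ φ Q ∧ Q.inertia (N ≃ₐ[ℚ] N) = ⊥ ∧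
                  g * φ * g⁻¹ = σ), Real.log p := by
  obtain ⟨L₁, c, hL₁, hc, hc4, h⟩ := frobeniusClass_PNT n hn (ε := 1 / 2) (by norm_num) (by norm_num)
  obtain ⟨c₁, hc₁, hc₁1, hMT⟩ := exceptional_mainTerm_ge n hn
  set L : ℝ := max L₁ 16 with hL
  refine ⟨L, c₁ / 8, lt_of_lt_of_le hL₁ (le_max_left _ _), by positivity, fun N _ _ _ hN σ hgen x hx => ?_⟩
  obtain ⟨hA, hB⟩ := h N hN σ hgen
  obtain ⟨hδ0, hδ1⟩ := classDensity_pos_le_one σ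
  set δ : ℝ := (Nat.card {τ : N ≃ₐ[ℚ] N // IsConj σ τ} : ℝ) / Nat.card (N ≃ₐ[ℚ] N) with hδ
  have hN1 : 1 < Module.finrank ℚ N := by rw [hN]; exact hn
  set d : ℝ := ((NumberField.discr N).natAbs : ℝ) with hd
  have hd3 : (3 : ℝ) ≤ d := three_le_natAbs_discr_real N hN1
  have hd1 : (1 : ℝ) ≤ d := by linarith
  have hx₁ : d ^ L₁ ≤ x := rpow_le_of_rpow_le hd1 (le_max_left _ _) hx
  have h16 : d ^ (16 : ℝ) ≤ x := rpow_le_of_rpow_le hd1 (le_max_right _ _) hx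
  have hx16 : 16 ≤ Real.log x := by
    have hlog3 : 1 ≤ Real.log d := by
      rw [Real.le_log_iff_exp_le (by linarith)]
      have := Real.exp_one_lt_d9; linarith
    have h1 := Real.log_le_log (Real.rpow_pos_of_pos (by linarith) _) h16
    rw [Real.log_rpow (by linarith)] at h1
    nlinarith
  have hx1 : 1 < x := by
    have := Real.add_one_le_exp (16 : ℝ)
    have h2 : Real.exp 16 ≤ x := by
      have := Real.exp_le_exp.mpr hx16
      rwa [Real.exp_log (by linarith [Real.rpow_pos_of_pos (show (0:ℝ) < d by linarith) L])] at this
    linarith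
  have hx0 : 0 < x := by linarith
  set D : ℝ := d ^ (2 * ((1 : ℝ) + n * n)) with hD
  have hD1 : 1 ≤ D := Real.one_le_rpow hd1 (by positivity)
  have hD0 : 0 < D := by linarith
  have hδx : 0 ≤ δ * x := by positivity
  -- the easy cases give `S ≥ δx/2 ≥ (c₁/8) δ x / D`
  have heasy : δ * x / 2 ≥ c₁ / 8 * (δ * x) / D := by
    rw [ge_iff_le, div_le_iff₀ hD0]
    have : c₁ / 8 * (δ * x) ≤ δ * x / 2 * 1 := by nlinarith
    nlinarith [mul_le_mul_of_nonneg_left hD1 (by positivity : 0 ≤ δ * x / 2)]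
  by_cases hexc : ∃ β₁ : ℝ, dedekindZeta₁ N β₁ = 0 ∧ 1 - c / (Real.log d + Real.log 4) < β₁ ∧ β₁ < 1
  · obtain ⟨β₁, hζ₁, hβ₁c, hβ₁1⟩ := hexc
    have hβ34 : 3 / 4 ≤ β₁ := three_quarters_le_of_window hc hc4 hd3 hβ₁c
    have hβ0 : 0 < β₁ := by linarith
    have hy0 : 0 ≤ x ^ β₁ / β₁ := div_nonneg (Real.rpow_nonneg hx0.le _) hβ0.le
    obtain ⟨hB1, hB2⟩ := hB β₁ hζ₁ hβ₁c hβ₁1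
    by_cases hζσ : dedekindZeta₁ (IntermediateField.fixedField (Subgroup.zpowers σ)) β₁ = 0
    · obtain ⟨hxy, hb⟩ := hB1 hζσ x hx₁
      have h1 := (abs_le.mp hb).1
      have hW : x * c₁ / (4 * D) ≤ x - x ^ β₁ / β₁ := hMT N hN β₁ hζ₁ hβ34 hβ₁1 x hx1 hx16
      -- `S ≥ δ (x − y)/2 ≥ δ x c₁/(8 D)`
      have h2 : c₁ / 8 * (δ * x) / D = δ * (x * c₁ / (4 * D)) / 2 := by field_simp; ring
      rw [h2]
      nlinarith [mul_le_mul_of_nonneg_left hW hδ0.le]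
    · have hb := hB2 hζσ x hx₁
      have h1 := (abs_le.mp hb).1
      nlinarith
  · have hb := hA hexc x hx₁
    have h1 := (abs_le.mp hb).1
    nlinarith

open scoped Classical in
/-- **The right order of magnitude when `σ` lies in no subgroup of index two**: for `n > 1`, `0 < ε ≤ 1`
there is `L > 0` such that for every Galois `N` of degree `n` and every `σ ∈ Gal(N/ℚ)` contained in no
index-two subgroup (e.g. an odd permutation of an `S_n`-extension; automatic if `|G|` is odd or `G` is perfect):
`S(x) ≥ (1 − ε) δ x` for every `x ≥ |d_N|^L` (in the exceptional case `σ ∉ K₁ = ker χ_exc`, so the exceptional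
term has the favourable sign).  Unconditional. [cite: LagariasMontgomeryOdlyzko1979, Theorem 1.1] -/
theorem frobeniusClass_theta_ge_of_forall_index_two (n : ℕ) (hn : 1 < n) {ε : ℝ} (hε : 0 < ε) (hε1 : ε ≤ 1) :
    ∃ L : ℝ, 0 < L ∧ ∀ (N : Type) [Field N] [NumberField N] [IsGalois ℚ N],
      Module.finrank ℚ N = n → ∀ σ : N ≃ₐ[ℚ] N, Subgroup.zpowers σ ≠ ⊤ →
        (∀ K : Subgroup (N ≃ₐ[ℚ] N), K.index = 2 → σ ∉ K) →
        ∀ x : ℝ, ((NumberField.discr N).natAbs : ℝ) ^ L ≤ x →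
          (1 - ε) * (((Nat.card {τ : N ≃ₐ[ℚ] N // IsConj σ τ} : ℝ) / Nat.card (N ≃ₐ[ℚ] N)) * x) ≤
          ∑ p ∈ (Nat.primesLE ⌊x⌋₊).filter
            (fun p : ℕ => ¬ ((p : ℤ) ∣ NumberField.discr N) ∧
              ∃ (Q : Ideal (𝓞 N)) (_ : Q.IsMaximal) (_ : Q.LiesOver (span {(p : ℤ)})) (φ g : N ≃ₐ[ℚ] N),
                IsArithFrobAt ℤ φ Q ∧ Q.inertia (N ≃ₐ[ℚ] N) = ⊥ ∧
                  g * φ * g⁻¹ = σ), Real.log p := by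
  obtain ⟨L, c, hL, hc, hc4, h⟩ := frobeniusClass_PNT n hn hε hε1
  refine ⟨L, hL, fun N _ _ _ hN σ hgen hσ x hx => ?_⟩
  obtain ⟨hA, hB⟩ := h N hN σ hgen
  obtain ⟨hδ0, hδ1⟩ := classDensity_pos_le_one σ
  set δ : ℝ := (Nat.card {τ : N ≃ₐ[ℚ] N // IsConj σ τ} : ℝ) / Nat.card (N ≃ₐ[ℚ] N) with hδ
  have hN1 : 1 < Module.finrank ℚ N := by rw [hN]; exact hn
  set d : ℝ := ((NumberField.discr N).natAbs : ℝ) with hd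
  have hd3 : (3 : ℝ) ≤ d := three_le_natAbs_discr_real N hN1
  have hx1 : 1 ≤ x := le_trans (Real.one_le_rpow (by linarith) hL.le) hx
  have hx0 : 0 < x := by linarith
  have hδx : 0 ≤ δ * x := by positivity
  by_cases hexc : ∃ β₁ : ℝ, dedekindZeta₁ N β₁ = 0 ∧ 1 - c / (Real.log d + Real.log 4) < β₁ ∧ β₁ < 1
  · obtain ⟨β₁, hζ₁, hβ₁c, hβ₁1⟩ := hexc
    have hβ34 : 3 / 4 ≤ β₁ := three_quarters_le_of_window hc hc4 hd3 hβ₁c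
    have hβ0 : 0 < β₁ := by linarith
    have hy0 : 0 ≤ x ^ β₁ / β₁ := div_nonneg (Real.rpow_nonneg hx0.le _) hβ0.le
    obtain ⟨K₁, hK₁, hHS⟩ := exists_index_two_of_exceptional hN1 hc4 hζ₁ hβ₁c hβ₁1
    have hζσ : dedekindZeta₁ (IntermediateField.fixedField (Subgroup.zpowers σ)) β₁ ≠ 0 := fun h0 =>
      hσ K₁ hK₁ ((hHS _).mp h0 (Subgroup.mem_zpowers σ))
    have hb := (hB β₁ hζ₁ hβ₁c hβ₁1).2 hζσ x hx
    have h1 := (abs_le.mp hb).1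
    have h1ε : 0 ≤ 1 - ε := by linarith
    nlinarith [mul_nonneg h1ε (mul_nonneg hδ0.le hy0)]
  · have hb := hA hexc x hx
    have h1 := (abs_le.mp hb).1
    nlinarith

open scoped Classical in
/-- **No subgroup of index two ⟹ no exceptional term**: for `n > 1`, `0 < ε ≤ 1` there is `L > 0` such that
for every Galois `N` of degree `n` whose Galois group has no subgroup of index two (so `N` has no quadratic
subfield and `ζ_N` has no exceptional zero, Heilbronn–Stark) and every `σ`: `|S(x) − δ x| ≤ ε δ x` for every
`x ≥ |d_N|^L`.  Unconditional. [cite: LagariasMontgomeryOdlyzko1979, Theorem 1.1] [cite: Stark1974, Theorem 3] -/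
theorem frobeniusClass_theta_twoSided_of_forall_index_ne_two (n : ℕ) (hn : 1 < n) {ε : ℝ} (hε : 0 < ε)
    (hε1 : ε ≤ 1) :
    ∃ L : ℝ, 0 < L ∧ ∀ (N : Type) [Field N] [NumberField N] [IsGalois ℚ N],
      Module.finrank ℚ N = n → (∀ K : Subgroup (N ≃ₐ[ℚ] N), K.index ≠ 2) → ∀ σ : N ≃ₐ[ℚ] N,
        Subgroup.zpowers σ ≠ ⊤ → ∀ x : ℝ, ((NumberField.discr N).natAbs : ℝ) ^ L ≤ x →
          |∑ p ∈ (Nat.primesLE ⌊x⌋₊).filter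
              (fun p : ℕ => ¬ ((p : ℤ) ∣ NumberField.discr N) ∧
                ∃ (Q : Ideal (𝓞 N)) (_ : Q.IsMaximal) (_ : Q.LiesOver (span {(p : ℤ)})) (φ g : N ≃ₐ[ℚ] N),
                  IsArithFrobAt ℤ φ Q ∧ Q.inertia (N ≃ₐ[ℚ] N) = ⊥ ∧
                    g * φ * g⁻¹ = σ), Real.log p -
            (Nat.card {τ : N ≃ₐ[ℚ] N // IsConj σ τ} : ℝ) / Nat.card (N ≃ₐ[ℚ] N) * x| ≤
            ε * ((Nat.card {τ : N ≃ₐ[ℚ] N // IsConj σ τ} : ℝ) / Nat.card (N ≃ₐ[ℚ] N) * x) := by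
  obtain ⟨L, c, hL, hc, hc4, h⟩ := frobeniusClass_PNT n hn hε hε1
  refine ⟨L, hL, fun N _ _ _ hN hG σ hgen x hx => ?_⟩
  have hN1 : 1 < Module.finrank ℚ N := by rw [hN]; exact hn
  refine (h N hN σ hgen).1 ?_ x hx
  rintro ⟨β₁, hζ₁, hβ₁c, hβ₁1⟩
  obtain ⟨K₁, hK₁, -⟩ := exists_index_two_of_exceptional hN1 hc4 hζ₁ hβ₁c hβ₁1
  exact hG K₁ hK₁

open scoped Classical in
/-- **The prime count**: for `n > 1`, `0 < ε ≤ 1` there is `L > 0` such that for every Galois `N` of degree `n`,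
every `σ` in no index-two subgroup and every `x ≥ |d_N|^L`:
`#{p ≤ x : p ∤ d_N, Frob_p ∈ C(σ)} ≥ (1 − ε) δ x / log x`.  Unconditional.
[cite: LagariasMontgomeryOdlyzko1979, Theorem 1.1] -/
theorem frobeniusClass_card_ge_of_forall_index_two (n : ℕ) (hn : 1 < n) {ε : ℝ} (hε : 0 < ε) (hε1 : ε ≤ 1) :
    ∃ L : ℝ, 0 < L ∧ ∀ (N : Type) [Field N] [NumberField N] [IsGalois ℚ N],
      Module.finrank ℚ N = n → ∀ σ : N ≃ₐ[ℚ] N, Subgroup.zpowers σ ≠ ⊤ →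
        (∀ K : Subgroup (N ≃ₐ[ℚ] N), K.index = 2 → σ ∉ K) →
        ∀ x : ℝ, ((NumberField.discr N).natAbs : ℝ) ^ L ≤ x →
          (1 - ε) * (((Nat.card {τ : N ≃ₐ[ℚ] N // IsConj σ τ} : ℝ) / Nat.card (N ≃ₐ[ℚ] N)) * x) /
              Real.log x ≤
          (((Nat.primesLE ⌊x⌋₊).filter
            (fun p : ℕ => ¬ ((p : ℤ) ∣ NumberField.discr N) ∧
              ∃ (Q : Ideal (𝓞 N)) (_ : Q.IsMaximal) (_ : Q.LiesOver (span {(p : ℤ)})) (φ g : N ≃ₐ[ℚ] N),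
                IsArithFrobAt ℤ φ Q ∧ Q.inertia (N ≃ₐ[ℚ] N) = ⊥ ∧
                  g * φ * g⁻¹ = σ)).card : ℝ) := by
  obtain ⟨L₁, hL₁, h⟩ := frobeniusClass_theta_ge_of_forall_index_two n hn hε hε1
  set L : ℝ := max L₁ 1 with hL
  refine ⟨L, lt_of_lt_of_le hL₁ (le_max_left _ _), fun N _ _ _ hN σ hgen hσ x hx => ?_⟩
  have hN1 : 1 < Module.finrank ℚ N := by rw [hN]; exact hn
  set d : ℝ := ((NumberField.discr N).natAbs : ℝ) with hd
  have hd3 : (3 : ℝ) ≤ d := three_le_natAbs_discr_real N hN1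
  have hd1 : (1 : ℝ) ≤ d := by linarith
  have hx₁ : d ^ L₁ ≤ x := rpow_le_of_rpow_le hd1 (le_max_left _ _) hx
  have hx3 : (3 : ℝ) ≤ x := by
    have := rpow_le_of_rpow_le hd1 (le_max_right _ _) hx; rw [Real.rpow_one] at this; linarith
  have hlogx : 0 < Real.log x := Real.log_pos (by linarith)
  have hS := h N hN σ hgen hσ x hx₁
  rw [div_le_iff₀ hlogx]
  exact hS.trans (sum_log_le_card_mul_log (by linarith) (Finset.filter_subset _ _))

end Summit.QuantumAdvantage.QuantumAdvantage.Theorems.DegreeOnePrimesEscape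

end
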